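import Literature.NumberTheory.PAdicHodge.TateAlmostEtalePackageStep
import HarnessLib

/-!
# Tate's almost étale lemma along Galois `p`-towers: the `p`-primary dévissage
# (Tate 1967 §3.2 Prop. 9 / Berger–Colmez (TS1))

Notation of `TateAlmostEtalePackageStep`: `K₀ = PadicBase F p hp`, `F̄ = NormedAlgClosure F`, `q = ‖p‖`,
`K_∞ = TateTrace.Kinf hp`, and for `K₀ ⊆ M ⊆ F̄` the almost-perfectoid package `pkg_s(M)` = (Γ) value
group `p`-divisible + (U_s) integers are `p`-th powers modulo `q^s`. Main result:

* `TateAlmostEtale.pGalois_package_and_trace` : **for every `M ⊇ K_∞` with `pkg_s(M)` and every finite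
  GALOIS extension `M ⊆ L ⊆ F̄` of `p`-power degree: `L` carries the package (`pkg_{s'}(L)` for some
  `s' > 0`) AND for every `ε > 0` there is `y ∈ L` with `Tr_{L/M}(y) = 1`, `‖y‖ ≤ q^{-ε}`** — Tate's
  Prop. 9 for the `p`-primary part, by induction on the degree: a central subgroup `N` of order `p` of
  `Gal(L/M)` (nontrivial centre of a `p`-group) cuts `L ⊇ L^N ⊇ M` with `L^N/M` Galois of degree `p^k`
  (induction) and `L/L^N` cyclic of degree `p`, hence Kummer (`μ_p ⊆ K_∞ ⊆ M`, Mathlib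
  `exists_root_adjoin_eq_top_of_isCyclic`); the top step is `TateAlmostEtaleKummerStep` (trace) and
  `TateAlmostEtalePackageStep` (package) over the base `L^N`; traces compose (`Algebra.trace_trace`).

In particular (`M = K_∞`, package from `CyclotomicTowerPthPowers`): **(TS1)/Prop. 9 holds for every
finite Galois `p`-extension of `K_∞`** (`Kinf_pGalois_trace`). What remains for the full (TS1): the
prime-to-`p` bottom of the Sylow dévissage (package of tame extensions of `K_∞`) — see the crux note
`Lines/kato-lever-TS1-kummer-route.md`. No `sorry`, no definitions; BSD is not proved by any of this.

References: [Tate1967] §3.2 Prop. 9; [BergerColmez2008] Déf. 3.1.3, Prop. 4.1.1.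
-/

noncomputable section

open Polynomial IntermediateField Module ValuativeRel Field

namespace Literature.NumberTheory.PAdicHodge

namespace TateAlmostEtale

open Literature.NumberTheory.GaloisRepresentations
open Literature.NumberTheory.GaloisRepresentations.IsNonarchimedeanLocalField

variable {F : Type} [Field F] [ValuativeRel F] [TopologicalSpace F] [IsNonarchimedeanLocalField F]
  [CharZero F] {p : ℕ} [Fact p.Prime] (hp : valuation F p < 1)

/-! ### Preliminaries -/

/-- `ζ_p ∈ K_∞`, and it is a primitive `p`-th root of unity. [cite: Tate1967, §3.1] -/
theorem zeta_one_mem_Kinf : CyclotomicTower.zeta F p 1 ∈ TateTrace.Kinf hp :=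
  TateTrace.K_le_Kinf hp 1 (CyclotomicTower.zeta_mem_K hp 1)

/-- A central subgroup of prime order: every nontrivial finite `p`-group `G` has a normal subgroup `N`
of order `p` (generated by an element of order `p` of the centre). [folklore] -/
private theorem exists_normal_card_eq {G : Type*} [Group G] [Finite G] {k : ℕ}
    (hG : Nat.card G = p ^ (k + 1)) :
    ∃ N : Subgroup G, N.Normal ∧ Nat.card N = p ∧ IsCyclic N := by
  have hprime : p.Prime := Fact.out
  haveI : Fact p.Prime := ⟨hprime⟩
  have hpg : IsPGroup p G := IsPGroup.of_card hG
  haveI : Nontrivial G := by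
    rw [← Finite.one_lt_card_iff_nontrivial, hG]
    exact Nat.one_lt_pow (Nat.succ_ne_zero k) hprime.one_lt
  haveI : Nontrivial (Subgroup.center G) := hpg.center_nontrivial
  have hZ : IsPGroup p (Subgroup.center G) := hpg.to_subgroup _
  have hdvd : p ∣ Nat.card (Subgroup.center G) := by
    rcases hZ.card_eq_or_dvd with h | h
    · exact absurd h (Finite.one_lt_card.ne')
    · exact h
  haveI := Fintype.ofFinite (Subgroup.center G)
  rw [Nat.card_eq_fintype_card] at hdvd
  obtain ⟨z, hz⟩ := exists_prime_orderOf_dvd_card p hdvd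
  refine ⟨Subgroup.zpowers (z : G), ?_, ?_, ?_⟩
  · refine ⟨fun n hn g => ?_⟩
    have hn' : n ∈ Subgroup.center G :=
      (Subgroup.zpowers_le.mpr z.2) hn
    rw [Subgroup.mem_center_iff] at hn'
    rw [hn' g, mul_assoc, mul_inv_cancel, mul_one]
    exact hn
  · rw [Nat.card_zpowers, Subgroup.orderOf_coe, hz]
  · exact Subgroup.isCyclic_zpowers _

/-! ### The induction -/

section Induction

set_option synthInstance.maxHeartbeats 200000 in
set_option maxHeartbeats 1600000 in
/-- The statement proved by induction on `k`: package + trace for Galois extensions of degree `p^k`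
of bases `M ⊇ K_∞` with the package (spelled out; public form `pGalois_package_and_trace`). The induction
step handles nested subtypes `M ⊆ L^N ⊆ L ⊆ F̄`, whence the raised instance-search budget. [folklore] -/
private theorem pGalois_aux (k : ℕ) :
    ∀ (M : IntermediateField (PadicBase F p hp) (NormedAlgClosure F)), TateTrace.Kinf hp ≤ M →
    ∀ (s : ℝ), 0 < s →
    (∀ x ∈ M, x ≠ 0 → ∃ c ∈ M, ‖c‖ ^ p = ‖x‖) →
    (∀ u ∈ M, ‖u‖ ≤ 1 → ∃ w ∈ M, ‖u - w ^ p‖ ≤ ‖(p : NormedAlgClosure F)‖ ^ s) →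
    ∀ (L : IntermediateField M (NormedAlgClosure F)) [FiniteDimensional M L] [IsGalois M L],
    finrank M L = p ^ k →
      (∃ s' : ℝ, 0 < s' ∧ (∀ x ∈ L, x ≠ 0 → ∃ c ∈ L, ‖c‖ ^ p = ‖x‖) ∧
        (∀ u ∈ L, ‖u‖ ≤ 1 → ∃ w ∈ L, ‖u - w ^ p‖ ≤ ‖(p : NormedAlgClosure F)‖ ^ s')) ∧
      ∀ ε : ℝ, 0 < ε → ∃ y : L, Algebra.trace M L y = 1 ∧
        ‖(y : NormedAlgClosure F)‖ ≤ ‖(p : NormedAlgClosure F)‖ ^ (-ε) := by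
  have hprime : p.Prime := Fact.out
  have hp0 : (p : NormedAlgClosure F) ≠ 0 := Nat.cast_ne_zero.mpr hprime.ne_zero
  have hq0 : 0 < ‖(p : NormedAlgClosure F)‖ := norm_pos_iff.mpr hp0
  have hq1 : ‖(p : NormedAlgClosure F)‖ < 1 := by
    rw [PadicBase.norm_natCast_closure hp]; exact PadicBase.norm_p_lt_one hp
  induction k with
  | zero =>
    intro M hKM s hs hΓ hU L _ _ hfin
    rw [pow_zero] at hfin
    have hbot : L = ⊥ := IntermediateField.finrank_eq_one_iff.mp hfin
    have hmem : ∀ x : NormedAlgClosure F, x ∈ L ↔ x ∈ M := by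
      intro x
      rw [hbot, IntermediateField.mem_bot]
      constructor
      · rintro ⟨m, rfl⟩; exact m.2
      · intro hx; exact ⟨⟨x, hx⟩, rfl⟩
    refine ⟨⟨s, hs, fun x hx hx0 => ?_, fun u hu hu1 => ?_⟩, fun ε hε => ?_⟩
    · obtain ⟨c, hc, h⟩ := hΓ x ((hmem x).mp hx) hx0
      exact ⟨c, (hmem c).mpr hc, h⟩
    · obtain ⟨w, hw, h⟩ := hU u ((hmem u).mp hu) hu1
      exact ⟨w, (hmem w).mpr hw, h⟩
    · refine ⟨1, ?_, ?_⟩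
      · haveI : Module.Free M L := Module.Free.of_divisionRing M L
        rw [show (1 : L) = algebraMap M L 1 from (map_one _).symm, Algebra.trace_algebraMap, hfin,
          one_smul]
      · have : ((1 : L) : NormedAlgClosure F) = 1 := rfl
        rw [this, norm_one]
        exact Real.one_le_rpow_of_pos_of_le_one_of_nonpos hq0 hq1.le (by linarith)
  | succ k IH =>
    intro M hKM s hs hΓ hU L _ _ hfin
    classical
    haveI : Module.Free M L := Module.Free.of_divisionRing M L
    -- a central subgroup `N` of order `p` of the Galois group
    have hcard : Nat.card (L ≃ₐ[M] L) = p ^ (k + 1) := by rw [IsGalois.card_aut_eq_finrank, hfin]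
    obtain ⟨N, hN, hNcard, hNcyc⟩ := exists_normal_card_eq (p := p) hcard
    haveI := hN
    haveI := hNcyc
    -- `L₁ = L^N`: `[L : L₁] = p`, `[L₁ : M] = p^k`, `L₁/M` Galois
    set L₁ : IntermediateField M L := IntermediateField.fixedField N with hL₁
    haveI : Module.Free M L₁ := Module.Free.of_divisionRing M L₁
    haveI : Module.Free L₁ L := Module.Free.of_divisionRing L₁ L
    have hfin₁L : finrank L₁ L = p := by
      rw [hL₁, IntermediateField.finrank_fixedField_eq_card, hNcard]
    have hfinM₁ : finrank M L₁ = p ^ k := by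
      have h := Module.finrank_mul_finrank M L₁ L
      rw [hfin₁L, hfin, pow_succ] at h
      exact Nat.eq_of_mul_eq_mul_right hprime.pos h
    haveI : IsGalois M L₁ := IsGalois.of_fixedField_normal_subgroup N
    -- the lift `L₁e ⊆ F̄` and the induction hypothesis
    set L₁e : IntermediateField M (NormedAlgClosure F) := IntermediateField.lift L₁ with hL₁e
    let e₁ : L₁ ≃ₐ[M] L₁e := IntermediateField.liftAlgEquiv L₁
    have he₁ : ∀ z : L₁, ((e₁ z : L₁e) : NormedAlgClosure F) = ((z : L) : NormedAlgClosure F) :=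
      fun z => IntermediateField.liftAlgEquiv_apply L₁ z
    haveI : FiniteDimensional M L₁e := LinearEquiv.finiteDimensional e₁.toLinearEquiv
    haveI : IsGalois M L₁e := IsGalois.of_algEquiv e₁
    have hfin₁e : finrank M L₁e = p ^ k := by rw [← e₁.toLinearEquiv.finrank_eq, hfinM₁]
    obtain ⟨⟨s₁, hs₁, hΓ₁, hU₁⟩, htr₁⟩ := IH M hKM s hs hΓ hU L₁e hfin₁e
    -- the base of the top step: `M₁ = L₁e` as an intermediate field over `K₀`
    set M₁ : IntermediateField (PadicBase F p hp) (NormedAlgClosure F) :=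
      L₁e.restrictScalars (PadicBase F p hp) with hM₁
    have hmemM₁ : ∀ x : NormedAlgClosure F, x ∈ M₁ ↔ x ∈ L₁e := fun x =>
      IntermediateField.mem_restrictScalars (PadicBase F p hp)
    have hΓM₁ : ∀ x ∈ M₁, x ≠ 0 → ∃ c ∈ M₁, ‖c‖ ^ p = ‖x‖ := by
      intro x hx hx0
      obtain ⟨c, hc, h⟩ := hΓ₁ x ((hmemM₁ x).mp hx) hx0
      exact ⟨c, (hmemM₁ c).mpr hc, h⟩
    have hUM₁ : ∀ u ∈ M₁, ‖u‖ ≤ 1 → ∃ w ∈ M₁, ‖u - w ^ p‖ ≤ ‖(p : NormedAlgClosure F)‖ ^ s₁ := by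
      intro u hu hu1
      obtain ⟨w, hw, h⟩ := hU₁ u ((hmemM₁ u).mp hu) hu1
      exact ⟨w, (hmemM₁ w).mpr hw, h⟩
    -- Kummer generation of `L/L₁`
    haveI : IsGalois L₁ L := IsGalois.tower_top_of_isGalois M L₁ L
    haveI : IsCyclic (L ≃ₐ[L₁] L) :=
      isCyclic_of_surjective (IntermediateField.subgroupEquivAlgEquiv N) (MulEquiv.surjective _)
    have hζM : CyclotomicTower.zeta F p 1 ∈ M := hKM (zeta_one_mem_Kinf hp)
    have hζL : algebraMap M (NormedAlgClosure F) ⟨_, hζM⟩ ∈ L := IntermediateField.algebraMap_mem L _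
    set ζL : L := ⟨CyclotomicTower.zeta F p 1, hζL⟩ with hζLdef
    have hζL₁ : ζL ∈ L₁ := by
      rw [hL₁, IntermediateField.mem_fixedField_iff]
      intro g _
      have : ζL = algebraMap M L ⟨_, hζM⟩ := Subtype.ext rfl
      rw [this, AlgEquiv.commutes]
    have hprim : (primitiveRoots (finrank L₁ L) L₁).Nonempty := by
      rw [hfin₁L]
      refine ⟨⟨ζL, hζL₁⟩, ?_⟩
      rw [mem_primitiveRoots hprime.pos]
      have hinj : Function.Injective ((algebraMap L (NormedAlgClosure F)).comp (algebraMap L₁ L)) :=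
        (algebraMap L (NormedAlgClosure F)).injective.comp (algebraMap L₁ L).injective
      refine IsPrimitiveRoot.of_map_of_injective (f := (algebraMap L (NormedAlgClosure F)).comp
        (algebraMap L₁ L)) ?_ hinj
      have h1 := CyclotomicTower.zeta_spec F p 1
      rw [pow_one] at h1
      exact h1
    obtain ⟨α, ⟨a₁, ha₁⟩, hgen⟩ := exists_root_adjoin_eq_top_of_isCyclic L₁ L hprim
    rw [hfin₁L] at ha₁
    have hirr₁ : Irreducible (X ^ p - C a₁) := by
      have h := irreducible_X_pow_sub_C_of_root_adjoin_eq_top (K := L₁) (L := L) (a := a₁) (α := α)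
        (by rw [hfin₁L]; exact ha₁.symm) hgen
      rwa [hfin₁L] at h
    -- transport to the base `M₁`
    let eM : L₁ ≃+* M₁ := e₁.toRingEquiv
    have heM : ∀ z : L₁, ((eM z : M₁) : NormedAlgClosure F) = ((z : L) : NormedAlgClosure F) := he₁
    set a' : M₁ := eM a₁ with ha'
    have hirr' : Irreducible (X ^ p - C a') := by
      have h : Polynomial.mapEquiv eM (X ^ p - C a₁) = X ^ p - C a' := by
        rw [mapEquiv_apply, Polynomial.map_sub, Polynomial.map_pow, map_X, map_C]
        rfl
      rw [← h, MulEquiv.irreducible_iff]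
      exact hirr₁
    set αE : NormedAlgClosure F := ((α : L) : NormedAlgClosure F) with hαE
    have hαE' : αE ^ p = (a' : NormedAlgClosure F) := by
      rw [ha', heM]
      change αE ^ p = ((algebraMap L₁ L a₁ : L) : NormedAlgClosure F)
      rw [ha₁, hαE]
      push_cast
      rfl
    -- the top step over `M₁`: package and trace of `M₁(α)`
    set s' : ℝ := min s₁ 1 / 2 with hs'
    have hs'0 : 0 < s' := by rw [hs']; positivity
    have hs'1 : s' < min s₁ 1 := by
      rw [hs']; linarith [lt_min hs₁ one_pos]
    have hΓ' : ∀ {x : NormedAlgClosure F}, x ∈ (↥M₁)⟮αE⟯ → x ≠ 0 →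
        ∃ c ∈ (↥M₁)⟮αE⟯, ‖c‖ ^ p = ‖x‖ :=
      fun hx hx0 => adjoin_exists_norm_pow_eq hp M₁ hΓM₁ hirr' hαE' hx hx0
    have hU' : ∀ {u : NormedAlgClosure F}, u ∈ (↥M₁)⟮αE⟯ → ‖u‖ ≤ 1 →
        ∃ w ∈ (↥M₁)⟮αE⟯, ‖u - w ^ p‖ ≤ ‖(p : NormedAlgClosure F)‖ ^ s' :=
      fun hu hu1 => adjoin_exists_norm_sub_pow_le hp M₁ hs₁ hΓM₁ hUM₁ hirr' hαE' hs'0 hs'1 hu hu1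
    -- `M₁(α) = L` as sets
    have hM₁L : M₁ ≤ L.restrictScalars (PadicBase F p hp) := by
      intro x hx
      rw [IntermediateField.mem_restrictScalars]
      exact IntermediateField.lift_le L₁ ((hmemM₁ x).mp hx)
    set Lext : IntermediateField M₁ (NormedAlgClosure F) := IntermediateField.extendScalars hM₁L with hLext
    have hmemLext : ∀ x : NormedAlgClosure F, x ∈ Lext ↔ x ∈ L := fun x => Iff.rfl
    let j : L ≃+* Lext :=
      { toFun := fun x => ⟨x.1, (hmemLext x.1).mpr x.2⟩
        invFun := fun x => ⟨x.1, (hmemLext x.1).mp x.2⟩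
        left_inv := fun x => rfl
        right_inv := fun x => rfl
        map_mul' := fun x y => rfl
        map_add' := fun x y => rfl }
    have hcompat : (algebraMap M₁ Lext).comp eM.toRingHom = j.toRingHom.comp (algebraMap L₁ L) := by
      ext z
      exact heM z
    have hfinLext : finrank M₁ Lext = p := by
      rw [← Algebra.finrank_eq_of_equiv_equiv eM j hcompat, hfin₁L]
    haveI : FiniteDimensional M₁ Lext := Module.finite_of_finrank_pos (by rw [hfinLext]; exact hprime.pos)
    have hintα : IsIntegral M₁ αE :=
      ⟨X ^ p - C a', monic_X_pow_sub_C a' hprime.ne_zero, by simp [hαE']⟩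
    have hfinadj : finrank M₁ (↥M₁)⟮αE⟯ = p := by
      have hmin : minpoly M₁ αE = X ^ p - C a' :=
        (minpoly.eq_of_irreducible_of_monic hirr' (by simp [hαE']) (monic_X_pow_sub_C a' hprime.ne_zero)).symm
      rw [adjoin.finrank hintα, hmin, natDegree_X_pow_sub_C]
    have hadjle : (↥M₁)⟮αE⟯ ≤ Lext := by
      rw [adjoin_simple_le_iff]; exact (hmemLext αE).mpr (α : L).2
    have hadjeq : (↥M₁)⟮αE⟯ = Lext :=
      IntermediateField.eq_of_le_of_finrank_eq hadjle (by rw [hfinadj, hfinLext])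
    have hmemadj : ∀ x : NormedAlgClosure F, x ∈ (↥M₁)⟮αE⟯ ↔ x ∈ L := fun x => by
      rw [hadjeq]; exact hmemLext x
    -- package of `L`
    refine ⟨⟨s', hs'0, fun x hx hx0 => ?_, fun u hu hu1 => ?_⟩, fun ε hε => ?_⟩
    · obtain ⟨c, hc, h⟩ := hΓ' ((hmemadj x).mpr hx) hx0
      exact ⟨c, (hmemadj c).mp hc, h⟩
    · obtain ⟨w, hw, h⟩ := hU' ((hmemadj u).mpr hu) hu1
      exact ⟨w, (hmemadj w).mp hw, h⟩
    -- trace: `y = y₂ · y₁`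
    have hε2 : 0 < ε / 2 := by linarith
    obtain ⟨y₁, hy₁, hy₁n⟩ := htr₁ (ε / 2) hε2
    obtain ⟨y₂, hy₂, hy₂n⟩ := exists_trace_eq_one_norm_le_of_kummer M₁ hprime hp0 hq1 hs₁ hΓM₁ hUM₁
      hirr' hαE' hε2
    set y₁' : L₁ := e₁.symm y₁ with hy₁'
    have hy₁'tr : Algebra.trace M L₁ y₁' = 1 := by
      rw [← Algebra.trace_eq_of_algEquiv e₁ y₁', hy₁', AlgEquiv.apply_symm_apply, hy₁]
    have hy₁'E : (((y₁' : L₁) : L) : NormedAlgClosure F) = (y₁ : NormedAlgClosure F) := by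
      rw [← he₁ y₁', hy₁', AlgEquiv.apply_symm_apply]
    set y₂' : L := ⟨(y₂ : NormedAlgClosure F), (hmemadj _).mp y₂.2⟩ with hy₂'
    -- transport `Tr_{M₁(α)/M₁}(y₂) = 1` to `Tr_{L/L₁}(y₂') = 1`
    let j₂ : L ≃+* (↥M₁)⟮αE⟯ :=
      { toFun := fun x => ⟨x.1, (hmemadj x.1).mpr x.2⟩
        invFun := fun x => ⟨x.1, (hmemadj x.1).mp x.2⟩
        left_inv := fun x => rfl
        right_inv := fun x => rfl
        map_mul' := fun x y => rfl
        map_add' := fun x y => rfl }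
    have hcompat₂ : (algebraMap M₁ (↥M₁)⟮αE⟯).comp (eM : L₁ →+* M₁) =
        (j₂ : L →+* (↥M₁)⟮αE⟯).comp (algebraMap L₁ L) := by
      ext z
      exact heM z
    have hy₂'tr : Algebra.trace L₁ L y₂' = 1 := by
      rw [Algebra.trace_eq_of_equiv_equiv eM j₂ hcompat₂ y₂']
      have : j₂ y₂' = y₂ := Subtype.ext rfl
      rw [this, hy₂, map_one]
    refine ⟨y₂' * algebraMap L₁ L y₁', ?_, ?_⟩
    · rw [← Algebra.trace_trace (S := L₁), show y₂' * algebraMap L₁ L y₁' = y₁' • y₂' by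
        rw [Algebra.smul_def, mul_comm], LinearMap.map_smul, hy₂'tr, smul_eq_mul, mul_one, hy₁'tr]
    · have : (((y₂' * algebraMap L₁ L y₁' : L)) : NormedAlgClosure F) =
          (y₂ : NormedAlgClosure F) * (y₁ : NormedAlgClosure F) := by
        rw [← hy₁'E]; rfl
      rw [this, norm_mul]
      calc ‖(y₂ : NormedAlgClosure F)‖ * ‖(y₁ : NormedAlgClosure F)‖
          ≤ ‖(p : NormedAlgClosure F)‖ ^ (-(ε / 2)) * ‖(p : NormedAlgClosure F)‖ ^ (-(ε / 2)) := by
            gcongr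
        _ = ‖(p : NormedAlgClosure F)‖ ^ (-ε) := by
            rw [← Real.rpow_add hq0]; ring_nf

/-- **Tate's almost étale lemma along Galois `p`-towers, with the package.** Let `K_∞ ⊆ M ⊆ F̄` carry
the almost-perfectoid package `pkg_s(M)` and let `M ⊆ L ⊆ F̄` be a finite Galois extension of degree
`p^k`. Then `L` carries the package (`pkg_{s'}(L)` for some `s' > 0`) and for every `ε > 0` there is
`y ∈ L` with `Tr_{L/M}(y) = 1` and `‖y‖ ≤ ‖p‖^{-ε}` (Prop. 9 for the `p`-primary part; induction through
a central subgroup of order `p`, Kummer theory, `TateAlmostEtaleKummerStep` and `TateAlmostEtalePackageStep`).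
[cite: Tate1967, §3.2 Prop. 9] [cite: BergerColmez2008, Prop. 4.1.1] -/
theorem pGalois_package_and_trace (M : IntermediateField (PadicBase F p hp) (NormedAlgClosure F))
    (hKM : TateTrace.Kinf hp ≤ M) {s : ℝ} (hs : 0 < s)
    (hΓ : ∀ x ∈ M, x ≠ 0 → ∃ c ∈ M, ‖c‖ ^ p = ‖x‖)
    (hU : ∀ u ∈ M, ‖u‖ ≤ 1 → ∃ w ∈ M, ‖u - w ^ p‖ ≤ ‖(p : NormedAlgClosure F)‖ ^ s)
    (L : IntermediateField M (NormedAlgClosure F)) [FiniteDimensional M L] [IsGalois M L]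
    {k : ℕ} (hfin : finrank M L = p ^ k) :
    (∃ s' : ℝ, 0 < s' ∧ (∀ x ∈ L, x ≠ 0 → ∃ c ∈ L, ‖c‖ ^ p = ‖x‖) ∧
        (∀ u ∈ L, ‖u‖ ≤ 1 → ∃ w ∈ L, ‖u - w ^ p‖ ≤ ‖(p : NormedAlgClosure F)‖ ^ s')) ∧
      ∀ ε : ℝ, 0 < ε → ∃ y : L, Algebra.trace M L y = 1 ∧
        ‖(y : NormedAlgClosure F)‖ ≤ ‖(p : NormedAlgClosure F)‖ ^ (-ε) :=
  pGalois_aux hp k M hKM s hs hΓ hU L hfin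

/-- **(TS1)/Prop. 9 PROVED for the finite Galois `p`-extensions of `K_∞`.** For every finite Galois
extension `K_∞ ⊆ L ⊆ F̄` of `p`-power degree and every `ε > 0` there is `y ∈ L` with `Tr_{L/K_∞}(y) = 1`
and `‖y‖ ≤ ‖p‖^{-ε}` (package of `K_∞`: `CyclotomicTowerPthPowers`). The remaining part of the Tate–Sen
axiom `tate1967_TS1_completedAlgClosure` (via `TateSenConditionOfAlmostEtale`) is the prime-to-`p`
(tame) bottom of the Sylow dévissage. [cite: Tate1967, §3.2 Prop. 9] [cite: BergerColmez2008, Prop. 4.1.1] -/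
theorem Kinf_pGalois_trace (L : IntermediateField (TateTrace.Kinf hp) (NormedAlgClosure F))
    [FiniteDimensional (TateTrace.Kinf hp) L] [IsGalois (TateTrace.Kinf hp) L] {k : ℕ}
    (hfin : finrank (TateTrace.Kinf hp) L = p ^ k) {ε : ℝ} (hε : 0 < ε) :
    ∃ y : L, Algebra.trace (TateTrace.Kinf hp) L y = 1 ∧
      ‖(y : NormedAlgClosure F)‖ ≤ ‖(p : NormedAlgClosure F)‖ ^ (-ε) := by
  refine (pGalois_package_and_trace hp (TateTrace.Kinf hp) le_rfl one_pos
    (fun x hx hx0 => Kinf_exists_norm_pow_eq hp hx hx0) (fun u hu hu1 => ?_) L hfin).2 ε hε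
  rw [Real.rpow_one]
  exact Kinf_exists_norm_sub_pow_le hp hu hu1

/-- The package also propagates: every finite Galois `p`-extension of `K_∞` is almost-perfectoid.
[cite: Tate1967, §3.2 Prop. 9] [cite: BergerColmez2008, Prop. 4.1.1] -/
theorem Kinf_pGalois_package (L : IntermediateField (TateTrace.Kinf hp) (NormedAlgClosure F))
    [FiniteDimensional (TateTrace.Kinf hp) L] [IsGalois (TateTrace.Kinf hp) L] {k : ℕ}
    (hfin : finrank (TateTrace.Kinf hp) L = p ^ k) :
    ∃ s' : ℝ, 0 < s' ∧ (∀ x ∈ L, x ≠ 0 → ∃ c ∈ L, ‖c‖ ^ p = ‖x‖) ∧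
      (∀ u ∈ L, ‖u‖ ≤ 1 → ∃ w ∈ L, ‖u - w ^ p‖ ≤ ‖(p : NormedAlgClosure F)‖ ^ s') := by
  refine (pGalois_package_and_trace hp (TateTrace.Kinf hp) le_rfl one_pos
    (fun x hx hx0 => Kinf_exists_norm_pow_eq hp hx hx0) (fun u hu hu1 => ?_) L hfin).1
  rw [Real.rpow_one]
  exact Kinf_exists_norm_sub_pow_le hp hu hu1

end Induction

end TateAlmostEtale

end Literature.NumberTheory.PAdicHodge

end
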